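import Mathlib
import HarnessLib
import HarnessLib.Audit
import Summits.AtomisticToContinuum.Crystallization.Statement
import Summits.AtomisticToContinuum.Crystallization.Theses.OneCrossingRisingSea
import Summits.AtomisticToContinuum.Crystallization.Theorems.MinMeanCycleStackingLockBasedDefectVanishCrystallizes

/-!
# Crux `ClassOnePositional` (stmt-AtomisticToContinuum-12048) — birth skeleton (BC3)

Route `OneCrossingRisingSea`, sub-problem `Crystallization`, crux rank 2 (the positional half
`X_P` of the class-1 rising-sea thesis):

  for every CLASS-1 pair potential `V` (one-crossing Gaussian mixture, divergent core, a negative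
  value, summable tail `|V(r)| ≤ C r^-(3+ε)` on `r ≥ 1`, stable in `ℝ³`), the energetic form
  `HasPeriodicGroundStateEnergy V 3` implies the Blanc–Lewin positional form `IsCrystallizing V 3`.

## The line (two stubs; the cut announced in the route header's two-layer plan
"ClassOnePositional ⇐ class-wide BulkDefectVanish (0751-type) → DefectVanishCrystallizes-type glue",
with the glue taken from the tree, PROVED for a general potential:
`MinMeanCycleStackingLockBasedDefectVanishCrystallizes.isCrystallizing_of_bulkDefectVanishBased`)

* `stub_classOneMinimalDistance` — HARD-CORE HALF (size M–L): every class-1 potential has a uniform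
  minimal inter-particle distance in its ground states: `∃ δ > 0`, for every `N` and every ground
  state `x` of `N` particles, `dist (x i) (x j) ≥ δ` for `i ≠ j` — the class-wide form of the PROVED
  tree fact `LennardJonesMinimalDistance_holds` (Lennard-Jones, `δ = 1/3`). Mechanism: `E(N) ≤ E(N-1)`
  (`V → 0` at infinity), so each particle's one-body energy `Σ_j V(|x_i - x_j|)` is `≤ 0` in a ground
  state, and the divergent core must be paid for by the bounded attraction `V₋ ≤ ∫_0^{t₀}|w|` of
  boundedly many neighbours (local superstability bound).
* `stub_classOneClusterRigidity` — RIGIDITY HALF (size XL, load-bearing): for every class-1 `V` and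
  every periodic configuration `P₀` that is an energetic ground state (minimises the energy per
  particle over periodic configurations AND `E(N)/N → e(P₀)`), there is ONE periodic `P` such that for
  all `δ, R, ε, θ > 0` there are `η > 0` and `N₀` with: every `δ`-separated configuration of `N ≥ N₀`
  particles whose energy is at most `(e(P₀) + η)·N` has at most `θ·N` particles `i` that are NOT
  based-`(P, R, ε)`-good (no linear isometry `A` and base point `p ∈ P.points` with the particles of
  `B_R(x_i)` two-way `ε`-matched to `x_i + A((P.points - p) ∩ B̄_R(p))`). Quantitative rigidity of
  the class-1 crystal among FINITE near-minimal clusters; it is where "one length scale ⇒ no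
  aperiodic order" has to become a theorem, and where degenerate stackings at an fcc/hcp balance
  point of the class would break the line.
* `ClassOnePositional_of` — the kernel-checked composition (real proof, no sorry):
  `stub₁-signature → stub₂-signature → OneCrossingRisingSea.ClassOnePositional` BY NAME: from the
  energetic form take `P₀` (IsLeast + `E(N)/N → e(P₀)`); ground states are `δ`-separated (stub 1)
  and, since `E(N)/N → e(P₀)`, eventually have energy `≤ (e(P₀) + η)·N`, so stub 2 bounds the density
  of based-bad particles by every `θ > 0` eventually: the based bulk-defect-vanishing hypothesis of
  the landed glue `isCrystallizing_of_bulkDefectVanishBased`, which with the minimal distance yields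
  `IsCrystallizing V 3`.
* `ClassOnePositional_of_stubs : OneCrossingRisingSea.ClassOnePositional` — the crux BY NAME from the
  two stubs (the skeleton theorem of the audit; the only `sorry`s in its cone are the two `stub_*`).
  Same two-theorem layout as the registered skeleton `Cruxes/BulkDefectVanishBased/Lines/birth.lean`.

`sorry` occurs only inside the two `stub_*` theorems; the closing `example`s certify that the
inlined stub signatures are definitionally the named statements `ClassOneMinimalDistance` and
`ClassOneClusterRigidity` below.

Disproof used: none on file for this crux (`ledger crux ls stmt-AtomisticToContinuum-12048`: no
workfiles, 2026-08-17). Negatives of the summit touching positional rigidity — 4146 (1%-tolerance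
local Hales, a deterministic `∀ S` statement), 3506 (one-grain gluing `∀ P`), 15929 (12-shell census
at tolerance 1/50) — are not instances of either stub (stub 1 is a separation statement; stub 2 is an
`∃ P`, `∀ θ ∃ η` density statement over near-minimal clusters, not a pointwise shell certificate).
-/

namespace Summit.AtomisticToContinuum.Crystallization.Cruxes.ClassOnePositional.Birth

open Filter Topology
open Literature.MathematicalPhysics.StatisticalMechanics
open Summit.AtomisticToContinuum.Crystallization.Theorems.MinMeanCycleStackingLockBasedDefectVanishCrystallizes

/-! ## Named statements (documentation; the stubs inline them verbatim) -/

/-- The class-1 hypothesis of route `OneCrossingRisingSea`, verbatim the antecedent of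
`ClassOnePositional`: one-crossing Gaussian mixture, divergent core, a negative value, summable tail,
stability in `ℝ³`. -/
def IsClassOne (V : ℝ → ℝ) : Prop :=
  Literature.MathematicalPhysics.StatisticalMechanics.IsOneCrossingMixture V ∧ Filter.Tendsto V (nhdsWithin 0 (Set.Ioi 0)) Filter.atTop ∧ (∃ r : ℝ, 0 < r ∧ V r < 0) ∧ (∃ C ε : ℝ, 0 < ε ∧ ∀ r : ℝ, 1 ≤ r → |V r| ≤ C * r ^ (-(3 + ε))) ∧ (∃ B : ℝ, ∀ (N : ℕ) (x : Fin N → EuclideanSpace ℝ (Fin 3)), Function.Injective x → -(B * (N : ℝ)) ≤ Literature.MathematicalPhysics.StatisticalMechanics.interactionEnergy V x)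

/-- **Statement of stub 1 — uniform minimal distance of class-1 ground states.** -/
def ClassOneMinimalDistance : Prop :=
  ∀ V : ℝ → ℝ, IsClassOne V → ∃ δ : ℝ, 0 < δ ∧ ∀ (N : ℕ) (x : Fin N → EuclideanSpace ℝ (Fin 3)), Literature.MathematicalPhysics.StatisticalMechanics.IsGroundState V x → ∀ i j : Fin N, i ≠ j → δ ≤ dist (x i) (x j)

/-- **Statement of stub 2 — near-minimal cluster rigidity of the class-1 crystal (based windows).** -/
def ClassOneClusterRigidity : Prop :=
  ∀ V : ℝ → ℝ, IsClassOne V → ∀ P₀ : Literature.MathematicalPhysics.StatisticalMechanics.PeriodicConfiguration 3, IsLeast (Set.range fun Q : Literature.MathematicalPhysics.StatisticalMechanics.PeriodicConfiguration 3 => Q.energyPerParticle V) (P₀.energyPerParticle V) → Filter.Tendsto (fun N : ℕ => Literature.MathematicalPhysics.StatisticalMechanics.groundStateEnergy V 3 N / N) Filter.atTop (nhds (P₀.energyPerParticle V)) → ∃ P : Literature.MathematicalPhysics.StatisticalMechanics.PeriodicConfiguration 3, ∀ δ R ε θ : ℝ, 0 < δ → 0 < R → 0 < ε → 0 < θ →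 ∃ η : ℝ, 0 < η ∧ ∃ N₀ : ℕ, ∀ N : ℕ, N₀ ≤ N → ∀ x : Fin N → EuclideanSpace ℝ (Fin 3), (∀ i j : Fin N, i ≠ j → δ ≤ dist (x i) (x j)) → Literature.MathematicalPhysics.StatisticalMechanics.interactionEnergy V x ≤ (P₀.energyPerParticle V + η) * N → (Nat.card {i : Fin N // ¬ ∃ A : EuclideanSpace ℝ (Fin 3) →ₗᵢ[ℝ] EuclideanSpace ℝ (Fin 3), ∃ p ∈ P.points, (∀ q ∈ P.points, dist q p ≤ R → ∃ j : Fin N, dist (x j) (x i + A (q - p)) ≤ ε) ∧ (∀ j : Fin N, dist (x j) (x i) ≤ R → ∃ q ∈ P.points, dist (x j) (x i + A (q - p)) ≤ ε)} : ℝ) ≤ θ * N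

/-! ## The stubs -/

/-- **Stub 1 — uniform minimal distance of class-1 ground states (HARD-CORE HALF).** For every
class-1 potential `V` there is `δ > 0` such that in every ground state of every particle number the
particles are pairwise `δ`-separated. Class-wide form of the PROVED `LennardJonesMinimalDistance_holds`
(`δ = 1/3` for `r⁻¹²/12 - r⁻⁶/6`; Xue 1997, Blanc–Lewin 2015 §2.2). Why plausibly true: `V → 0` at
infinity gives `E(N) ≤ E(N-1)`, hence `Σ_{j ≠ i} V(|x_i - x_j|) ≤ 0` at every particle of a ground
state; the attraction is bounded (`V ≥ -∫_0^{t₀}|w|`) and summable, the core diverges, so a close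
pair forces unboundedly many neighbours in a bounded ball, against a local superstability bound.
Why it might fail: for the softest members of the class (cores diverging slower than `r⁻³`)
stability need not upgrade to a uniform local density bound. Size M–L. -/
theorem stub_classOneMinimalDistance : ∀ V : ℝ → ℝ, (Literature.MathematicalPhysics.StatisticalMechanics.IsOneCrossingMixture V ∧ Filter.Tendsto V (nhdsWithin 0 (Set.Ioi 0)) Filter.atTop ∧ (∃ r : ℝ, 0 < r ∧ V r < 0) ∧ (∃ C ε : ℝ, 0 < ε ∧ ∀ r : ℝ, 1 ≤ r → |V r| ≤ C * r ^ (-(3 + ε))) ∧ (∃ B : ℝ, ∀ (N : ℕ) (x : Fin N → EuclideanSpace ℝ (Fin 3)), Function.Injective x → -(B * (N : ℝ)) ≤ Literature.MathematicalPhysics.StatisticalMechanics.interactionEnergy V x)) → ∃ δ : ℝ, 0 < δ ∧ ∀ (N : ℕ) (x : Fin N → EuclideanSpace ℝ (Fin 3)), Literature.MathematicalPhysics.StatisticalMechanics.IsGroundState V x → ∀ i j : Fin N, i ≠ j → δ ≤ dist (x i) (x j) := by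
  sorry

/-- **Stub 2 — near-minimal cluster rigidity of the class-1 crystal (RIGIDITY HALF, load-bearing).**
For every class-1 `V` and every periodic `P₀` that is an energetic ground state (`e(P₀)` minimal over
periodic configurations and `E(N)/N → e(P₀)`) there is ONE periodic `P` such that for all
`δ, R, ε, θ > 0` there are `η > 0`, `N₀` with: every `δ`-separated configuration of `N ≥ N₀`
particles with energy `≤ (e(P₀) + η)·N` has at most `θ·N` particles that are not
based-`(P, R, ε)`-good (two-way `ε`-matching of `B_R(x_i)` with `x_i + A((P.points - p) ∩ B̄_R(p))`
for some linear isometry `A` and base point `p ∈ P.points`; the predicate of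
`isCrystallizing_of_bulkDefectVanishBased`). Why plausibly true: class 1 has one length scale (single
well, one-crossing registry couplings, no second Fourier ring), so the periodic minimiser should be
isolated and coercive modulo isometries, and a near-minimal finite cluster can deviate from it only
on a boundary/grain-boundary set of vanishing density. Why it might fail: degenerate minimisers
(fcc/hcp balance point of the class, soft tails ⇒ polytypes of unbounded period) or amorphous/
icosahedral clusters reaching `e(P₀)` in the limit. Size XL. -/
theorem stub_classOneClusterRigidity : ∀ V : ℝ → ℝ, (Literature.MathematicalPhysics.StatisticalMechanics.IsOneCrossingMixture V ∧ Filter.Tendsto V (nhdsWithin 0 (Set.Ioi 0)) Filter.atTop ∧ (∃ r : ℝ, 0 < r ∧ V r < 0) ∧ (∃ C ε : ℝ, 0 < ε ∧ ∀ r : ℝ, 1 ≤ r → |V r| ≤ C * r ^ (-(3 + ε))) ∧ (∃ B : ℝ, ∀ (N : ℕ) (x : Fin N → EuclideanSpace ℝ (Fin 3)), Function.Injective x → -(B * (N : ℝ)) ≤ Literature.MathematicalPhysics.StatisticalMechanics.interactionEnergy V x)) → ∀ P₀ : Literature.MathematicalPhysics.StatisticalMechanics.PeriodicConfiguration 3,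 IsLeast (Set.range fun Q : Literature.MathematicalPhysics.StatisticalMechanics.PeriodicConfiguration 3 => Q.energyPerParticle V) (P₀.energyPerParticle V) → Filter.Tendsto (fun N : ℕ => Literature.MathematicalPhysics.StatisticalMechanics.groundStateEnergy V 3 N / N) Filter.atTop (nhds (P₀.energyPerParticle V)) → ∃ P : Literature.MathematicalPhysics.StatisticalMechanics.PeriodicConfiguration 3, ∀ δ R ε θ : ℝ, 0 < δ → 0 < R → 0 < ε → 0 < θ → ∃ η : ℝ, 0 < η ∧ ∃ N₀ : ℕ, ∀ N : ℕ, N₀ ≤ N → ∀ x : Fin N → EuclideanSpace ℝ (Fin 3), (∀ i j : Fin N, i ≠ j → δ ≤ dist (x i) (x j)) → Literature.MathematicalPhysics.StatisticalMechanics.interactionEnergy V x ≤ (P₀.energyPerParticle V + η) * N → (Nat.card {i : Fin N // ¬ ∃ A : EuclideanSpace ℝ (Fin 3) →ₗᵢ[ℝ] EuclideanSpace ℝ (Fin 3), ∃ p ∈ P.points, (∀ q ∈ P.points, dist q p ≤ R → ∃ j : Fin N, dist (x j) (x i + A (q - p)) ≤ ε) ∧ (∀ j : Fin N, dist (x j)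 (x i) ≤ R → ∃ q ∈ P.points, dist (x j) (x i + A (q - p)) ≤ ε)} : ℝ) ≤ θ * N := by
  sorry

/-! ## The composition (kernel-checked, no sorry) -/

/-- **Composition** `stub₁-signature → stub₂-signature → ClassOnePositional` (the crux BY NAME), real
proof: destructure the energetic form into `P₀`, `IsLeast`, `E(N)/N → e(P₀)`; stub 1 gives the
separation `δ` of all ground states; stub 2 (at `P₀`, `δ`) gives `P` and, for each `(R, ε, θ)`, a
threshold `η`; since `E(N)/N → e(P₀)`, eventually `E(N) < (e(P₀) + η)·N`, so along every sequence of
ground states the density of based-`(P, R, ε)`-bad particles is eventually `≤ θ/2 < θ` — i.e. tends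
to `0` — which is the hypothesis of the landed glue `isCrystallizing_of_bulkDefectVanishBased`
(Theorems/MinMeanCycleStackingLockBasedDefectVanishCrystallizes.lean, general `V`, `d`, `P`). -/
theorem ClassOnePositional_of : (∀ V : ℝ → ℝ, (Literature.MathematicalPhysics.StatisticalMechanics.IsOneCrossingMixture V ∧ Filter.Tendsto V (nhdsWithin 0 (Set.Ioi 0)) Filter.atTop ∧ (∃ r : ℝ, 0 < r ∧ V r < 0) ∧ (∃ C ε : ℝ, 0 < ε ∧ ∀ r : ℝ, 1 ≤ r → |V r| ≤ C * r ^ (-(3 + ε))) ∧ (∃ B : ℝ, ∀ (N : ℕ) (x : Fin N → EuclideanSpace ℝ (Fin 3)), Function.Injective x → -(B * (N : ℝ)) ≤ Literature.MathematicalPhysics.StatisticalMechanics.interactionEnergy V x)) → ∃ δ : ℝ, 0 < δ ∧ ∀ (N : ℕ) (x : Fin N → EuclideanSpace ℝ (Fin 3)), Literature.MathematicalPhysics.StatisticalMechanics.IsGroundState V x → ∀ i j : Fin N, i ≠ j → δ ≤ dist (x i) (x j)) → (∀ V : ℝ → ℝ, (Literature.MathematicalPhysics.StatisticalMechanics.IsOneCrossingMixture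 V ∧ Filter.Tendsto V (nhdsWithin 0 (Set.Ioi 0)) Filter.atTop ∧ (∃ r : ℝ, 0 < r ∧ V r < 0) ∧ (∃ C ε : ℝ, 0 < ε ∧ ∀ r : ℝ, 1 ≤ r → |V r| ≤ C * r ^ (-(3 + ε))) ∧ (∃ B : ℝ, ∀ (N : ℕ) (x : Fin N → EuclideanSpace ℝ (Fin 3)), Function.Injective x → -(B * (N : ℝ)) ≤ Literature.MathematicalPhysics.StatisticalMechanics.interactionEnergy V x)) → ∀ P₀ : Literature.MathematicalPhysics.StatisticalMechanics.PeriodicConfiguration 3, IsLeast (Set.range fun Q : Literature.MathematicalPhysics.StatisticalMechanics.PeriodicConfiguration 3 => Q.energyPerParticle V) (P₀.energyPerParticle V) → Filter.Tendsto (fun N : ℕ => Literature.MathematicalPhysics.StatisticalMechanics.groundStateEnergy V 3 N / N) Filter.atTop (nhds (P₀.energyPerParticle V)) → ∃ P : Literature.MathematicalPhysics.StatisticalMechanics.PeriodicConfiguration 3, ∀ δ R ε θ : ℝ, 0 < δ → 0 < R → 0 < ε → 0 < θ → ∃ η : ℝ, 0 < η ∧ ∃ N₀ : ℕ, ∀ N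 : ℕ, N₀ ≤ N → ∀ x : Fin N → EuclideanSpace ℝ (Fin 3), (∀ i j : Fin N, i ≠ j → δ ≤ dist (x i) (x j)) → Literature.MathematicalPhysics.StatisticalMechanics.interactionEnergy V x ≤ (P₀.energyPerParticle V + η) * N → (Nat.card {i : Fin N // ¬ ∃ A : EuclideanSpace ℝ (Fin 3) →ₗᵢ[ℝ] EuclideanSpace ℝ (Fin 3), ∃ p ∈ P.points, (∀ q ∈ P.points, dist q p ≤ R → ∃ j : Fin N, dist (x j) (x i + A (q - p)) ≤ ε) ∧ (∀ j : Fin N, dist (x j) (x i) ≤ R → ∃ q ∈ P.points, dist (x j) (x i + A (q - p)) ≤ ε)} : ℝ) ≤ θ * N) → Summit.AtomisticToContinuum.Crystallization.Theses.OneCrossingRisingSea.ClassOnePositional := by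
  intro h1 h2 V hV hE
  obtain ⟨δ, hδ, hsep⟩ := h1 V hV
  obtain ⟨P₀, hleast, hlim⟩ := hE
  obtain ⟨P, hP⟩ := h2 V hV P₀ hleast hlim
  refine isCrystallizing_of_bulkDefectVanishBased P ?_ hδ hsep
  intro R ε hR hε x hx
  rw [Metric.tendsto_nhds]
  intro θ hθ
  obtain ⟨η, hη, N₀, hN₀⟩ := hP δ R ε (θ / 2) hδ hR hε (by positivity)
  have hev : ∀ᶠ N : ℕ in atTop,
      groundStateEnergy V 3 N / N < P₀.energyPerParticle V + η :=
    hlim.eventually_lt_const (by linarith)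
  filter_upwards [hev, eventually_ge_atTop N₀, eventually_ge_atTop 1] with N hN hNN₀ hN1
  have hNpos : (0 : ℝ) < N := by exact_mod_cast hN1
  have hEN : interactionEnergy V (x N) ≤ (P₀.energyPerParticle V + η) * N := by
    rw [(hx N).2]
    exact ((div_lt_iff₀ hNpos).1 hN).le
  have hcard := hN₀ N hNN₀ (x N) (fun i j hij => hsep N (x N) (hx N) i j hij) hEN
  rw [Real.dist_eq, sub_zero, abs_of_nonneg (by positivity)]
  calc (Nat.card {i : Fin N // ¬ ∃ A : EuclideanSpace ℝ (Fin 3) →ₗᵢ[ℝ] EuclideanSpace ℝ (Fin 3), ∃ p ∈ P.points, (∀ q ∈ P.points, dist q p ≤ R → ∃ j : Fin N, dist (x N j) (x N i + A (q - p)) ≤ ε) ∧ (∀ j : Fin N, dist (x N j) (x N i) ≤ R → ∃ q ∈ P.points, dist (x N j) (x N i + A (q - p)) ≤ ε)} : ℝ) / N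
      ≤ θ / 2 * N / N := by gcongr
    _ = θ / 2 := by field_simp
    _ < θ := by linarith

/-- **The crux BY NAME from the two stubs** (type literally the route decl; the only `sorry`s in its
cone are `stub_classOneMinimalDistance` and `stub_classOneClusterRigidity`). -/
theorem ClassOnePositional_of_stubs :
    Summit.AtomisticToContinuum.Crystallization.Theses.OneCrossingRisingSea.ClassOnePositional :=
  ClassOnePositional_of stub_classOneMinimalDistance stub_classOneClusterRigidity

/-- By-name reading of the composition: the named statements imply the crux decl (certifies that the
inlined signatures of `ClassOnePositional_of` are definitionally these named statements). -/
example : ClassOneMinimalDistance → ClassOneClusterRigidity →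
    Summit.AtomisticToContinuum.Crystallization.Theses.OneCrossingRisingSea.ClassOnePositional :=
  fun h1 h2 => ClassOnePositional_of h1 h2

/-- The registered stub signatures are, definitionally, `ClassOneMinimalDistance` and
`ClassOneClusterRigidity`. -/
example : ClassOneMinimalDistance ∧ ClassOneClusterRigidity :=
  ⟨stub_classOneMinimalDistance, stub_classOneClusterRigidity⟩

/-- Consistency with the tree at the Lennard-Jones member of the class: stub 1 at `V = lennardJones`
is the PROVED Literature fact `LennardJonesMinimalDistance` (so the stub is inhabited-in-kind at the
one member the sub-problem asks about). -/
example (h : ClassOneMinimalDistance)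
    (hLJ : IsClassOne Literature.MathematicalPhysics.StatisticalMechanics.lennardJones) :
    Literature.MathematicalPhysics.StatisticalMechanics.LennardJonesMinimalDistance :=
  h _ hLJ

end Summit.AtomisticToContinuum.Crystallization.Cruxes.ClassOnePositional.Birth
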